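import Mathlib
import Literature.NumberTheory.Transcendental.KZHyperbolicLadder

/-!
# Stub `exists_isGeodesicPolytope_nonempty`
# (crux `OffTetraSectorKernel`, line `odd-hyperbolic-ladder`)

NON-VACUITY OF EVERY RUNG of Goncharov's hyperbolic scissors ladder. Rung `n` is the upper
half-space model `{p : Fin (n + 1) → ℝ | 0 < p (last n)}` of `ℍⁿ⁺¹` with the volume density
`t^{-(n+1)}` (`t = p (last n)`), and its objects are the finite-volume `ℚ̄`-geodesic polytopes
`KZ.IsGeodesicPolytope n`. For every `n` we exhibit a NONEMPTY such polytope with RATIONAL data: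
the shell `n + 1 < ∑ₗ pₗ² < n + 10` between two hemispheres centred at the boundary origin,
inside the vertical box `|xⱼ| < 1` (`j < n`). It is relatively compact in the open half-space
(on it `1 < t` and `|pₗ| ≤ n + 10`), so `t^{-(n+1)}` is continuous and bounded on a compact
neighbourhood and the hyperbolic volume is finite; it contains the point `(0, …, 0, √(n + 4))`.
In particular rung `n = 4` (Goncharov's weight-three rung `ℍ⁵`) is inhabited.

References: A. B. Goncharov, *Volumes of hyperbolic manifolds and mixed Tate motives* (1999), §1.1;
M. Kontsevich, D. Zagier, *Periods* (2001), §1.2.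
-/

noncomputable section

open Set MeasureTheory
open Literature.NumberTheory.Transcendental

namespace Summit.KontsevichZagierPeriods.HyperbolicBloch.OffTetraSectorKernel

/-- On the model polytope (`0 < t`, `|xⱼ| < 1`, `n + 1 < ∑ₗ pₗ²`) the height exceeds `1`:
`t² = ∑ₗ pₗ² − ∑ⱼ xⱼ² > (n + 1) − n`. [folklore] -/
theorem one_lt_height_of_box_shell {n : ℕ} {p : Fin (n + 1) → ℝ} (ht : 0 < p (Fin.last n))
    (hup : ∀ j : Fin n, p j.castSucc < 1) (hlow : ∀ j : Fin n, -1 < p j.castSucc)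
    (hshell : (n + 1 : ℝ) < ∑ l, p l ^ 2) : 1 < p (Fin.last n) := by
  have hx : ∑ j : Fin n, p j.castSucc ^ 2 ≤ n := by
    calc ∑ j : Fin n, p j.castSucc ^ 2 ≤ ∑ _j : Fin n, (1 : ℝ) :=
          Finset.sum_le_sum fun j _ => by nlinarith [hup j, hlow j]
      _ = n := by simp
  rw [Fin.sum_univ_castSucc] at hshell
  nlinarith [ht, hshell, hx]

/-- A point with `∑ₘ pₘ² < n + 10` lies in the box `[-(n + 10), n + 10]ⁿ⁺¹` (`pₗ² ≤ ∑ₘ pₘ²`).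
[folklore] -/
theorem abs_le_of_sum_sq_lt {n : ℕ} {p : Fin (n + 1) → ℝ} (hR : ∑ l, p l ^ 2 < n + 10)
    (l : Fin (n + 1)) : -(n + 10 : ℝ) ≤ p l ∧ p l ≤ n + 10 := by
  have hn : (0 : ℝ) ≤ n := Nat.cast_nonneg n
  have hl : p l ^ 2 ≤ ∑ m, p m ^ 2 :=
    Finset.single_le_sum (f := fun m => p m ^ 2) (fun m _ => sq_nonneg (p m))
      (Finset.mem_univ l)
  have hsq : (n + 10 : ℝ) ≤ (n + 10) ^ 2 := by nlinarith
  exact abs_le_of_sq_le_sq' (by linarith) (by linarith)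

/-- The model polytope of rung `n` — the points of the upper half-space with `|xⱼ| < 1` for the
`n` boundary coordinates and `n + 1 < ∑ₗ pₗ² < n + 10` (a spherical shell centred at the boundary
origin, cut by a vertical box) — has finite hyperbolic volume: `t^{-(n+1)}` is continuous on the
compact set `[-(n + 10), n + 10]ⁿ⁺¹ ∩ {1 ≤ t}` containing it. [folklore] -/
theorem integrableOn_hypDensity_rungShell (n : ℕ) :
    IntegrableOn (KZ.hypDensity n) {p : Fin (n + 1) → ℝ | 0 < p (Fin.last n) ∧
      (∀ j : Fin n, p j.castSucc < 1) ∧ (∀ j : Fin n, -1 < p j.castSucc) ∧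
      (n + 1 : ℝ) < ∑ l, p l ^ 2 ∧ ∑ l, p l ^ 2 < n + 10} := by
  set K : Set (Fin (n + 1) → ℝ) :=
    Set.pi Set.univ (fun _ => Set.Icc (-(n + 10 : ℝ)) (n + 10)) ∩ {p | 1 ≤ p (Fin.last n)} with hK
  have hKc : IsCompact K :=
    (isCompact_univ_pi fun _ => isCompact_Icc).inter_right
      (isClosed_le continuous_const (continuous_apply _))
  have hcont : ContinuousOn (KZ.hypDensity n) K := by
    show ContinuousOn (fun p : Fin (n + 1) → ℝ => 1 / p (Fin.last n) ^ (n + 1)) K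
    refine ContinuousOn.div₀ continuousOn_const ((continuous_apply _).pow _).continuousOn
      fun p hp => ?_
    exact pow_ne_zero _ (one_pos.trans_le hp.2).ne'
  refine (hcont.integrableOn_compact hKc).mono_set fun p hp => ?_
  obtain ⟨ht, hup, hlow, hshell, hR⟩ := hp
  exact ⟨fun l _ => abs_le_of_sum_sq_lt hR l, (one_lt_height_of_box_shell ht hup hlow hshell).le⟩

/-- The model polytope of rung `n` contains the point `(0, …, 0, √(n + 4))`. [folklore] -/
theorem rungShell_nonempty (n : ℕ) :
    ({p : Fin (n + 1) → ℝ | 0 < p (Fin.last n) ∧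
      (∀ j : Fin n, p j.castSucc < 1) ∧ (∀ j : Fin n, -1 < p j.castSucc) ∧
      (n + 1 : ℝ) < ∑ l, p l ^ 2 ∧ ∑ l, p l ^ 2 < n + 10}).Nonempty := by
  have hn : (0 : ℝ) ≤ n := Nat.cast_nonneg n
  refine ⟨Pi.single (Fin.last n) (Real.sqrt (n + 4)), ?_, fun j => ?_, fun j => ?_, ?_⟩
  · rw [Pi.single_eq_same]
    exact Real.sqrt_pos.2 (by linarith)
  · rw [Pi.single_eq_of_ne (Fin.castSucc_ne_last j)]
    exact one_pos
  · rw [Pi.single_eq_of_ne (Fin.castSucc_ne_last j)]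
    norm_num
  · have hsum :
        ∑ l, (Pi.single (Fin.last n) (Real.sqrt (n + 4)) : Fin (n + 1) → ℝ) l ^ 2 = n + 4 := by
      rw [Fin.sum_univ_castSucc, Pi.single_eq_same, Real.sq_sqrt (by linarith),
        Finset.sum_eq_zero fun j _ => ?_, zero_add]
      rw [Pi.single_eq_of_ne (Fin.castSucc_ne_last j), sq, mul_zero]
    rw [hsum]
    constructor <;> linarith

/-- **Every rung of the hyperbolic scissors ladder is inhabited.** For every `n`, the shell
`n + 1 < ∑ₗ pₗ² < n + 10` inside the vertical box `|xⱼ| < 1` is a nonempty finite-volume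
`ℚ̄`-geodesic polytope of `ℍⁿ⁺¹`: it is cut out of the upper half-space by `2n` vertical
hyperplanes `xⱼ = ±1` and two hemispheres centred at the boundary origin, all with rational data,
and `t^{-(n+1)} ≤ 1` on it. [cite: Goncharov1999, §1.1] -/
theorem exists_isGeodesicPolytope_nonempty : ∀ n : ℕ, ∃ P : Set (Fin (n + 1) → ℝ), Literature.NumberTheory.Transcendental.KZ.IsGeodesicPolytope n P ∧ P.Nonempty := by
  intro n
  refine ⟨{p : Fin (n + 1) → ℝ | 0 < p (Fin.last n) ∧
      (∀ j : Fin n, p j.castSucc < 1) ∧ (∀ j : Fin n, -1 < p j.castSucc) ∧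
      (n + 1 : ℝ) < ∑ l, p l ^ 2 ∧ ∑ l, p l ^ 2 < n + 10}, ?_, rungShell_nonempty n⟩
  -- constraint data, indexed by two blocks `Fin (n + 1)`: in block one, `j < n` is the flat
  -- face `xⱼ < 1` and `j = last` the round face `n + 1 < ∑ pₗ²`; in block two, `-1 < xⱼ` and
  -- `∑ pₗ² < n + 10`.
  refine ⟨(n + 1) + (n + 1),
    Fin.append (fun j : Fin (n + 1) => if j = Fin.last n then false else true)
      (fun j : Fin (n + 1) => if j = Fin.last n then false else true),
    Fin.append
      (fun j : Fin (n + 1) => if j = Fin.last n then (0 : Fin (n + 1) → ℝ) else Pi.single j 1)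
      (fun j : Fin (n + 1) => if j = Fin.last n then (0 : Fin (n + 1) → ℝ) else Pi.single j 1),
    Fin.append (fun j : Fin (n + 1) => if j = Fin.last n then (n + 1 : ℝ) else 1)
      (fun j : Fin (n + 1) => if j = Fin.last n then (n + 10 : ℝ) else -1),
    Fin.append (fun j : Fin (n + 1) => if j = Fin.last n then (1 : ℝ) else -1)
      (fun j : Fin (n + 1) => if j = Fin.last n then (-1 : ℝ) else 1),
    ?_, ?_, ?_, ?_, ?_, integrableOn_hypDensity_rungShell n⟩
  · -- the normal / centre vectors have entries `0` or `1`
    refine (Fin.forall_fin_add _).2 ⟨fun j l => ?_, fun j l => ?_⟩ <;>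
      simp only [Fin.append_left, Fin.append_right, ite_apply, Pi.zero_apply,
        Pi.single_apply] <;>
      split_ifs <;> first | exact isAlgebraic_zero | exact isAlgebraic_one
  · -- the levels `n + 1, 1, n + 10, -1` are rational
    refine (Fin.forall_fin_add _).2 ⟨fun j => ?_, fun j => ?_⟩ <;>
      simp only [Fin.append_left, Fin.append_right] <;> split_ifs
    exacts [(isAlgebraic_nat n).add isAlgebraic_one, isAlgebraic_one,
      (isAlgebraic_nat n).add (isAlgebraic_nat 10), isAlgebraic_one.neg]
  · -- signs
    refine (Fin.forall_fin_add _).2 ⟨fun j => ?_, fun j => ?_⟩ <;>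
      simp only [Fin.append_left, Fin.append_right] <;> split_ifs <;> simp
  · -- the faces are vertical / centred on the boundary
    refine (Fin.forall_fin_add _).2 ⟨fun j => ?_, fun j => ?_⟩ <;>
      simp only [Fin.append_left, Fin.append_right, ite_apply, Pi.zero_apply] <;>
      split_ifs with h <;> first | rfl | exact Pi.single_eq_of_ne' h 1
  · -- the constraints cut out exactly the shell-in-a-box
    ext p
    simp only [Set.mem_setOf_eq]
    refine and_congr_right fun _ => ?_
    simp only [Fin.forall_fin_add, Fin.forall_fin_succ', Fin.append_left, Fin.append_right,
      Fin.castSucc_ne_last, Bool.false_eq_true, ↓reduceIte,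
      Pi.zero_apply, sub_zero, Pi.single_apply, ite_mul, one_mul, zero_mul, Finset.sum_ite_eq',
      Finset.mem_univ, neg_mul, neg_sub, sub_neg_eq_add, sub_pos]
    constructor
    · rintro ⟨h1, h2, h3, h4⟩
      exact ⟨⟨h1, h3⟩, fun i => by linarith [h2 i], h4⟩
    · rintro ⟨⟨h1, h3⟩, h2, h4⟩
      exact ⟨h1, fun i => by linarith [h2 i], h3, h4⟩

end Summit.KontsevichZagierPeriods.HyperbolicBloch.OffTetraSectorKernel

end
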